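import Mathlib
import Summits.Ventures.PercRepro2.TB14Hall
import Summits.Ventures.PercRepro2.TB14Profile

/-!
# Row 2′TB: the LOCAL MONOTONE MATCHING (DOM-Z) as a named tree statement
(blind cell PercRepro2, mine-c g21, 2026-08-26; `conjectures/MINE-C.md` §30.4)

A SOURCE of row 2′TB is a configuration `y` with `Q` (`a₁ ↮ a₂` in both colours), `b ∈ C_red(a₁)`
and `o ∈ C_red(a₂) ∖ C_blue(a₂)`; a TARGET has `o ∈ C_blue(a₂) ∖ C_red(a₂)` instead
(`TB14FlipFamily.IsSrc` / `IsTgt`).  A (DOM-Z) MOVE `y ↦ y'` RELEASES a part `Z` of the red cluster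
of `a₂` containing `o` and keeps the rest: (a) the red cluster of `a₂` SHRINKS (`T(y') ⊆ T(y)`),
(b) `o ∈ Z := T(y) ∖ T(y')`, (c) `y' = y` on every edge not touching `Z`, (d) on the edges inside
`Z` the colouring is COMPLEMENTED (`y' e = ¬ y e`); the edges between `Z` and the outside are free
(the census shows this freedom is necessary) and the edges `Z`–`T(y')` are blue in `y'` by (a).
Under (a) every red edge outside `T(y)` stays red and outside `T(y')`, so the red cluster of `a₁`
(which lives outside `T(y)` under `Q`) only grows: a move of a source that is a target keeps `b`.

`DomZ` (a Prop, NOT a theorem) is HALL'S CONDITION for these moves on the sources of every finite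
multigraph at the all-free profile; `TB14_of_DomZ` shows it gives row 2′TB at every profile
through `TB14Hall.tb14_of_hall` and the profile reduction `TB14Cut.TB14_of_allFree`.  Census
(own code `data/mine-c/g21/fibre/dom4.c`, relation R26): a perfect matching of the sources into
the targets by (DOM-Z) moves exists on every instance of n = 5 (all 728 connected labelled graphs,
all roots and `o`: 17,640 instances), n = 6 (all 26,704 graphs, m ≤ 12: 1,426,200 instances) and
a 1/64 slice of n = 7, m ≤ 8 (464,677 instances) — 0 Hall failures; the same moves with the
outside edges of `Z` all red (the star flip) or the interior of `Z` all blue fail Hall at n = 5.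
Own work; standard axioms.
-/

namespace Summit.Ventures.PercRepro2

namespace TB14DomZ

open CovForm A3InactiveTyped TB14Fold TB14FlipFamily TB14Hall

section Moves

variable {V : Type} {E : Type}
variable (ends : E → Sym2 V) (a₂ : V)

/-- The RELEASED part of the move `y ↦ y'`: the vertices of the red cluster of `a₂` in `y` that are
not in its red cluster in `y'`. -/
def Released (y y' : Config E) (v : V) : Prop := Conn ends y a₂ v ∧ ¬ Conn ends y' a₂ v

/-- **A (DOM-Z) move** `y ↦ y'` (relation R26 of MINE-C.md §30.4): the red cluster of `a₂`
shrinks, `o` is released, the colouring is unchanged off the star of the released part and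
complemented inside it. -/
structure IsDomZMove (o : V) (y y' : Config E) : Prop where
  /-- (a) `T(y') ⊆ T(y)`. -/
  shrink : ∀ v, Conn ends y' a₂ v → Conn ends y a₂ v
  /-- (b) `o ∈ Z`. -/
  ho : Released ends a₂ y y' o
  /-- (c) `y' = y` on the edges not touching `Z`. -/
  off : ∀ e, (∀ x ∈ ends e, ¬ Released ends a₂ y y' x) → y' e = y e
  /-- (d) `y' = ¬ y` on the edges inside `Z`. -/
  inside : ∀ e, (∀ x ∈ ends e, Released ends a₂ y y' x) → y' e = !(y e)

end Moves

section Hall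

variable {V : Type} {E : Type} [Fintype E] [DecidableEq E]
variable (ends : E → Sym2 V) (a₁ a₂ b o : V) (F : Finset E)

open Classical in
/-- The (DOM-Z) moves of `y` that are targets of row 2′TB. -/
noncomputable def domZMoves (y : Config E) : Finset (Config E) :=
  Finset.univ.filter fun y' => IsTgt ends a₁ a₂ b o F y' ∧ IsDomZMove ends a₂ o y y'

open Classical in
/-- **Hall's condition for the (DOM-Z) moves** at the profile `(F, z)` of one instance: every set
`S` of admissible sources has at least `#S` targets reachable by a (DOM-Z) move. -/
def DomZHallAt (z : Config E) : Prop :=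
  ∀ S ⊆ srcSet ends a₁ a₂ b o F z, S.card ≤ (S.biUnion (domZMoves ends a₁ a₂ b o F)).card

open Classical in
/-- **(DOM-Z) Hall at the all-free profile gives the row there** (through `tb14_of_hall`). -/
theorem tb14_of_domZHallAt {R : Type*} [Field R] [LinearOrder R] [IsStrictOrderedRing R]
    (z : Config E) (hF : ∀ e, e ∈ F) (h : DomZHallAt ends a₁ a₂ b o F z) :
    pairCount F z (sameBO ends a₁ a₂ b o : Config E → Config E → R) ≤
      pairCount F z (crossBO ends a₁ a₂ b o) := by
  refine tb14_of_hall ends a₁ a₂ b o F z (domZMoves ends a₁ a₂ b o F) ?_ h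
  intro y _ w hw
  exact Finset.mem_filter.2
    ⟨Finset.mem_univ _, adm_of_allFree F z hF _, (Finset.mem_filter.1 hw).2.1⟩

end Hall

/-- **(DOM-Z)** (a Prop, NOT a theorem — the candidate of record of MINE-C.md §30.4): on every
finite multigraph, for every roots `a₁ a₂` and marks `b o`, Hall's condition holds for the
(DOM-Z) moves of the sources of row 2′TB at the all-free profile. -/
def DomZ : Prop :=
  ∀ (V E : Type) [Fintype E] [DecidableEq E] (ends : E → Sym2 V) (a₁ a₂ b o : V),
    DomZHallAt ends a₁ a₂ b o Finset.univ (fun _ => false)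

/-- **Row 2′TB follows from (DOM-Z)** at every profile. -/
theorem TB14_of_DomZ (R : Type*) [Field R] [LinearOrder R] [IsStrictOrderedRing R] (h : DomZ) :
    TB14 R :=
  TB14Cut.TB14_of_allFree R fun V E _ _ ends a₁ a₂ b o =>
    tb14_of_domZHallAt ends a₁ a₂ b o Finset.univ (fun _ => false) (fun e => Finset.mem_univ e)
      (h V E ends a₁ a₂ b o)

/-! ## The release moves without the complement — the statement of record after the n = 8 census
(mine-c g21, 2026-08-26T00:4xZ; MINE-C.md §30.4′)

The refinement (d) «the interior of `Z` is complemented» FAILS Hall at n = 8: on the graph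
`0-2 0-4 0-7 1-4 1-5 2-4 2-5 3-5 3-6 5-7` (8 vertices, 10 edges) with `a₁ = 3`, `a₂ = 1`, `b = 6`,
`o = 7` the 64 admissible sources have a maximum matching of only 63 into the targets by (DOM-Z)
moves (own codes `dom5.c` and `r26b.py`, two codes one seat; 0 failures on n ≤ 7 and on 200
random 8-vertex graphs with m ≤ 11, the first failures on 300 with m ≤ 12).  So `DomZ` above is a
FALSE Prop, kept as the record of the refinement; `TB14_of_DomZ` is a true, idle theorem.  The
moves WITHOUT (d) — (a) the red cluster of `a₂` shrinks, (b) `o` is released, (c) the colouring is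
unchanged off the star of the released part; the interior of `Z` and the edges from `Z` to the
outside FREE — satisfy Hall on every instance censused (relation R23 of MINE-C.md §30.4: n = 5
all graphs, n = 6 all graphs all m, a 1/64 slice of n = 7 m ≤ 8, 500 random 8-vertex graphs with
m ≤ 12, with and without the mark `b`; 0 failures): `DomZRelease` below, the candidate of record,
with `TB14_of_DomZRelease`.  A (DOM-Z) move is a release move, so `DomZ → DomZRelease`. -/

section Release

variable {V : Type} {E : Type}
variable (ends : E → Sym2 V) (a₂ : V)

/-- **A RELEASE move** `y ↦ y'` (relation R23 of MINE-C.md §30.4): the conditions (a)–(c) of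
`IsDomZMove` without the complement (d) — the red cluster of `a₂` shrinks, `o` is released, and
the colouring is unchanged off the star of the released part. -/
structure IsReleaseMove (o : V) (y y' : Config E) : Prop where
  /-- (a) `T(y') ⊆ T(y)`. -/
  shrink : ∀ v, Conn ends y' a₂ v → Conn ends y a₂ v
  /-- (b) `o ∈ Z`. -/
  ho : Released ends a₂ y y' o
  /-- (c) `y' = y` on the edges not touching `Z`. -/
  off : ∀ e, (∀ x ∈ ends e, ¬ Released ends a₂ y y' x) → y' e = y e

/-- A (DOM-Z) move is a release move. -/
theorem IsDomZMove.toRelease {o : V} {y y' : Config E} (h : IsDomZMove ends a₂ o y y') :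
    IsReleaseMove ends a₂ o y y' :=
  ⟨h.shrink, h.ho, h.off⟩

end Release

section ReleaseHall

variable {V : Type} {E : Type} [Fintype E] [DecidableEq E]
variable (ends : E → Sym2 V) (a₁ a₂ b o : V) (F : Finset E)

open Classical in
/-- The release moves of `y` that are targets of row 2′TB. -/
noncomputable def releaseMoves (y : Config E) : Finset (Config E) :=
  Finset.univ.filter fun y' => IsTgt ends a₁ a₂ b o F y' ∧ IsReleaseMove ends a₂ o y y'

open Classical in
/-- **Hall's condition for the release moves** at the profile `(F, z)` of one instance. -/
def ReleaseHallAt (z : Config E) : Prop :=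
  ∀ S ⊆ srcSet ends a₁ a₂ b o F z, S.card ≤ (S.biUnion (releaseMoves ends a₁ a₂ b o F)).card

open Classical in
/-- Every (DOM-Z) move is a release move. -/
theorem domZMoves_subset_releaseMoves (y : Config E) :
    domZMoves ends a₁ a₂ b o F y ⊆ releaseMoves ends a₁ a₂ b o F y := by
  intro w hw
  rw [domZMoves, Finset.mem_filter] at hw
  exact Finset.mem_filter.2 ⟨hw.1, hw.2.1, hw.2.2.toRelease ends a₂⟩

open Classical in
/-- Hall for the (DOM-Z) moves gives Hall for the release moves (more moves, the same sources). -/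
theorem releaseHallAt_of_domZHallAt (z : Config E) (h : DomZHallAt ends a₁ a₂ b o F z) :
    ReleaseHallAt ends a₁ a₂ b o F z := by
  intro S hS
  refine (h S hS).trans (Finset.card_le_card ?_)
  intro x hx
  rw [Finset.mem_biUnion] at hx ⊢
  obtain ⟨y, hy, hxy⟩ := hx
  exact ⟨y, hy, domZMoves_subset_releaseMoves ends a₁ a₂ b o F y hxy⟩

open Classical in
/-- **Release Hall at the all-free profile gives the row there** (through `tb14_of_hall`). -/
theorem tb14_of_releaseHallAt {R : Type*} [Field R] [LinearOrder R] [IsStrictOrderedRing R]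
    (z : Config E) (hF : ∀ e, e ∈ F) (h : ReleaseHallAt ends a₁ a₂ b o F z) :
    pairCount F z (sameBO ends a₁ a₂ b o : Config E → Config E → R) ≤
      pairCount F z (crossBO ends a₁ a₂ b o) := by
  refine tb14_of_hall ends a₁ a₂ b o F z (releaseMoves ends a₁ a₂ b o F) ?_ h
  intro y _ w hw
  exact Finset.mem_filter.2
    ⟨Finset.mem_univ _, adm_of_allFree F z hF _, (Finset.mem_filter.1 hw).2.1⟩

end ReleaseHall

/-- **(DOM-Z), release form** (a Prop, NOT a theorem — the candidate of record of MINE-C.md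
§30.4′): on every finite multigraph, for every roots `a₁ a₂` and marks `b o`, Hall's condition
holds for the release moves of the sources of row 2′TB at the all-free profile. -/
def DomZRelease : Prop :=
  ∀ (V E : Type) [Fintype E] [DecidableEq E] (ends : E → Sym2 V) (a₁ a₂ b o : V),
    ReleaseHallAt ends a₁ a₂ b o Finset.univ (fun _ => false)

/-- The complemented form implies the release form. -/
theorem DomZRelease_of_DomZ (h : DomZ) : DomZRelease :=
  fun V E _ _ ends a₁ a₂ b o =>
    releaseHallAt_of_domZHallAt ends a₁ a₂ b o Finset.univ (fun _ => false) (h V E ends a₁ a₂ b o)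

/-- **Row 2′TB follows from the release form of (DOM-Z)** at every profile. -/
theorem TB14_of_DomZRelease (R : Type*) [Field R] [LinearOrder R] [IsStrictOrderedRing R]
    (h : DomZRelease) : TB14 R :=
  TB14Cut.TB14_of_allFree R fun V E _ _ ends a₁ a₂ b o =>
    tb14_of_releaseHallAt ends a₁ a₂ b o Finset.univ (fun _ => false) (fun e => Finset.mem_univ e)
      (h V E ends a₁ a₂ b o)

end TB14DomZ

end Summit.Ventures.PercRepro2
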